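import Summits.CriticalPhenomena.PercolationContinuityZ3.Theorems.Transplant.SkelPhiParaCorridorKG
import HarnessLib

/-!
# N2 (frames-only node `SamePDropOfSkeletonFrm₁`, OPEN), LEVEL 1, (C) column: THE K-G CORRIDOR OF RECORD FOR A STEP ALONG THE SECOND AXIS
# (`du = N` after quadrant normalisation), IN THE SAME x-RUN FRAME — run along axis `1` (the y′-hops of `yPrmW`, window widened by `W`),
# ACROSS-parking along axis `0` (x-strides, `xParkPrmW`), ALONG-parking along axis `1` (y′-hops, `yParkPrmW`); the twin of SkelPhiParaCorridorKG
# (`du = E`) with the axes exchanged.  Everything is read in `runX φ c₀ n h σ` coordinates (`runY = swap ∘ runX`), so the readings of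
# SkelPhiParaCorridorKGRead (`xParkSchedC`, `yParkSchedC`) serve phases 2 and 3 verbatim; only the run phase (`yRunSchedB`, below) is new.
Differences from the x-direction (located): (i) a y′-hop's along progress is only known up to `dS := sHi − sLo ∈ {1, 2}` coarse rows, so the run's
along extent grows by `(N+1)·dS` (absorbed in the across-parking's start window `Wp₁`); (ii) the run drifts across by `v` columns per hop (drift line
`(N+1)·v`, absorbed in the origin `kgC₁Y`).
builds on p205010 (kernel theorem, internal audit signed; external expert review pending) — nothing in this file uses p205010; nothing here is a
claim about the open node `SamePDropOfSkeletonFrm₁`.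
Lane `prim-bschramm`, seat `prim-bschramm-p5` (gen 15; (C) lineage; (R-22) K-G); helper file (`--supports stmt-CriticalPhenomena-4575`).
* §1 `yRunPrmB`, `yRunPrmB_ok/_eb`, `dS` (+ `dS_eq`), `kgA₁Y⁻/kgA₁Y⁺` (the run's last-core across half-widths), `kgPark₁Y`, `kgPark₂Y`, `kgC₁Y`, `kgC₂Y`,
  `kgPark₁Y_ok`, `kgPark₂Y_ok` (slot ledger);
* §2 `kgJoin₁Y`, `kgJoin₂Y`, **`kgCorrSchedY`**, `kgCorrSchedY_params`;
* §3 `mem_kgCorrSchedY_core_zero` (start box `|y₁| ≤ q`, `−((n+v)⁺ + W) ≤ y₀ ≤ (n−v)⁺ + W`), **`kgCorrSchedY_core_last_subset`** (arrival box, explicit).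
[cite: KozmaNitzan2024, §4 Lemma 11 (pp. 22–23), Lemma 12 (pp. 23–25)] [cite: MartineauTassion2017, §3.2 Lemma 3.5, §4.3 Lemma 4.2]
-/

noncomputable section

namespace Summit.CriticalPhenomena.PercolationContinuityZ3.Theorems.Transplant

namespace Skelφ

open Literature.Probability.Percolation Literature.Probability.LatticeModels SimpleGraph
open Literature.Probability.Percolation.KozmaNitzan.Cells (oth oth_oth)
open ChainPlanar ChainPara

variable {V : Type}

/-- `oth 1 = 0`. [folklore] -/
private theorem oth_one' : oth (1 : Fin 2) = 0 := by decide

/-! ## §1 The three parameter records and their admissibility -/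

/-- **Phase 1, the y′-run with a widened window**: `yPrmW n ℓ h v R′ q N` with the across window `(n ∓ v)⁺ + W`. [this work] -/
def yRunPrmB (n ℓ : ℕ) (h v : ℤ) (R' q W N : ℕ) : ChainPara.RunPrm :=
  { yPrmW n ℓ h v R' q N with Wp := (n - v).toNat + W, Wm := (n + v).toNat + W }

/-- Admissibility of the widened y′-run (`1 ≤ n`, `|v| ≤ n`, layer inequality). [folklore] -/
theorem yRunPrmB_ok {n ℓ : ℕ} {h v : ℤ} (hn : 1 ≤ n) (hv : |v| ≤ n) (hlay : (n + h.natAbs : ℕ) ≤ (n : ℤ) * ℓ + 1) (R' q W N : ℕ) :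
    ChainPara.RunOK (yRunPrmB n ℓ h v R' q W N) := by
  have hok := yPrmW_ok hn hv hlay R' q N
  exact ⟨hok.hs0, hok.hs, hok.hsL, hok.hd, Nat.le_add_right _ _, Nat.le_add_right _ _⟩

/-- `eb = ea` for the widened y′-run. [folklore] -/
theorem yRunPrmB_eb (n ℓ : ℕ) (h v : ℤ) (R' q W N : ℕ) : (yRunPrmB n ℓ h v R' q W N).eb = (yRunPrmB n ℓ h v R' q W N).ea := rfl

/-- The along uncertainty of one y′-hop in coarse rows: `dS = ⌊nℓ/c⌋ + 2 − ⌊(nℓ+1)/c⌋ = sHi − sLo`. [this work] -/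
def dS (n ℓ : ℕ) (h : ℤ) : ℕ := n * ℓ / shearUnit n h + 2 - (n * ℓ + 1) / shearUnit n h

/-- `dS = sHi − sLo` of `yPrmW` (`1 ≤ n`). [folklore] -/
theorem dS_eq {n ℓ : ℕ} {h : ℤ} (hn : 1 ≤ n) (v : ℤ) (R' q W N : ℕ) :
    ((dS n ℓ h : ℕ) : ℤ) = (yRunPrmB n ℓ h v R' q W N).sHi - (yRunPrmB n ℓ h v R' q W N).sLo := by
  have hU : (0 : ℤ) < (shearUnit n h : ℕ) := shearUnit_pos hn h
  have hU' : 0 < shearUnit n h := by exact_mod_cast hU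
  show ((n * ℓ / shearUnit n h + 2 - (n * ℓ + 1) / shearUnit n h : ℕ) : ℤ) =
    (n : ℤ) * ℓ / (shearUnit n h : ℕ) + 1 - ((n : ℤ) * ℓ - (shearUnit n h : ℕ) + 1) / (shearUnit n h : ℕ)
  have h1 : ((n : ℤ) * ℓ - (shearUnit n h : ℕ) + 1) / (shearUnit n h : ℕ) = ((n : ℤ) * ℓ + 1) / (shearUnit n h : ℕ) - 1 := by
    have e : (n : ℤ) * ℓ - (shearUnit n h : ℕ) + 1 = ((n : ℤ) * ℓ + 1) + (-1) * (shearUnit n h : ℕ) := by ring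
    rw [e, Int.add_mul_ediv_right _ _ hU.ne']; ring
  have h2 : (n * ℓ + 1) / shearUnit n h ≤ n * ℓ / shearUnit n h + 1 := by
    have h3 : (n * ℓ + 1) / shearUnit n h ≤ (n * ℓ + shearUnit n h) / shearUnit n h := Nat.div_le_div_right (by omega)
    rw [Nat.add_div_right _ hU'] at h3; exact h3
  rw [Nat.cast_sub (by omega)]
  push_cast
  rw [h1]; ring

/-- The across half-widths of the y′-run's last core (relative to the drift line `(N+1)v`): `A⁻ = (n+v)⁺ + W + (N+1)R′`, `A⁺ = (n−v)⁺ + W + (N+1)R′`. -/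
def kgA₁Ym (n : ℕ) (v : ℤ) (R' W N : ℕ) : ℕ := (n + v).toNat + W + (N + 1) * R'

/-- See `kgA₁Ym`. [this work] -/
def kgA₁Yp (n : ℕ) (v : ℤ) (R' W N : ℕ) : ℕ := (n - v).toNat + W + (N + 1) * R'

/-- **Phase 2, the ACROSS-parking along axis `0`** (`xParkPrmW` started on the y′-run's last core): along `[−A⁻, A⁺]` (columns, relative to the drift
line), window `q + (N+1)R′` below / `q + (N+1)R′ + (N+1)·dS` above (the run's along spread), `m₁ + 1` strides. [this work] -/
def kgPark₁Y (n ℓ : ℕ) (h v : ℤ) (R' ρ q W N m₁ : ℕ) : ChainPara.ParkPrm :=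
  xParkPrmW n ℓ h R' ρ (-((kgA₁Ym n v R' W N : ℕ) : ℤ)) (kgA₁Yp n v R' W N) (q + (N + 1) * R') (q + (N + 1) * R' + (N + 1) * dS n ℓ h) m₁

/-- **Phase 3, the ALONG-parking along axis `1`** (`yParkPrmW` started on phase 2's last core). [this work] -/
def kgPark₂Y (n ℓ : ℕ) (h v : ℤ) (R' ρ q W N m₁ Wm₂ Wp₂ m₂ : ℕ) : ChainPara.ParkPrm :=
  yParkPrmW n ℓ h v R' ρ ((kgPark₁Y n ℓ h v R' ρ q W N m₁).bLo (m₁ + 1)) ((kgPark₁Y n ℓ h v R' ρ q W N m₁).bHi (m₁ + 1)) Wm₂ Wp₂ m₂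

/-- Origin of phase 2: `((N+1)·v, (N+1)·sLo)` (drift line across, the run's minimal along progress). [this work] -/
def kgC₁Y (n ℓ : ℕ) (h v : ℤ) (N : ℕ) : Site 2 :=
  fun j => if j = 0 then ((N : ℤ) + 1) * v else ((N : ℤ) + 1) * (((n : ℤ) * ℓ - (shearUnit n h : ℕ) + 1) / (shearUnit n h : ℕ))

/-- Origin of phase 3: `(s, (N+1)·sLo)` with `s = (N+1)v + aHi₁(m₁+1) − Wp₂`. [this work] -/
def kgC₂Y (n ℓ : ℕ) (h v : ℤ) (R' ρ q W N m₁ Wp₂ : ℕ) : Site 2 :=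
  fun j => if j = 0 then ((N : ℤ) + 1) * v + (kgPark₁Y n ℓ h v R' ρ q W N m₁).aHi (m₁ + 1) - Wp₂
    else ((N : ℤ) + 1) * (((n : ℤ) * ℓ - (shearUnit n h : ℕ) + 1) / (shearUnit n h : ℕ))

/-- First coordinate of `kgC₁Y`. [folklore] -/
@[simp] theorem kgC₁Y_zero (n ℓ : ℕ) (h v : ℤ) (N : ℕ) : kgC₁Y n ℓ h v N 0 = ((N : ℤ) + 1) * v := rfl
/-- Second coordinate of `kgC₁Y`. [folklore] -/
@[simp] theorem kgC₁Y_one (n ℓ : ℕ) (h v : ℤ) (N : ℕ) :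
    kgC₁Y n ℓ h v N 1 = ((N : ℤ) + 1) * (((n : ℤ) * ℓ - (shearUnit n h : ℕ) + 1) / (shearUnit n h : ℕ)) := rfl
/-- First coordinate of `kgC₂Y`. [folklore] -/
@[simp] theorem kgC₂Y_zero (n ℓ : ℕ) (h v : ℤ) (R' ρ q W N m₁ Wp₂ : ℕ) :
    kgC₂Y n ℓ h v R' ρ q W N m₁ Wp₂ 0 = ((N : ℤ) + 1) * v + (kgPark₁Y n ℓ h v R' ρ q W N m₁).aHi (m₁ + 1) - Wp₂ := rfl
/-- Second coordinate of `kgC₂Y`. [folklore] -/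
@[simp] theorem kgC₂Y_one (n ℓ : ℕ) (h v : ℤ) (R' ρ q W N m₁ Wp₂ : ℕ) :
    kgC₂Y n ℓ h v R' ρ q W N m₁ Wp₂ 1 = ((N : ℤ) + 1) * (((n : ℤ) * ℓ - (shearUnit n h : ℕ) + 1) / (shearUnit n h : ℕ)) := rfl

/-- **SLOT LEDGER, phase 2 (y-direction)**: `1 ≤ n`, `2R′ + ρ ≤ n`, `ρ ≤ ⌊3nℓ/c⌋ + 1`, `2(⌊nℓ/c⌋ + 1) ≤ 2(q + (N+1)R′) + (N+1)dS`. [this work] -/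
theorem kgPark₁Y_ok {n ℓ : ℕ} {h v : ℤ} {R' ρ q W N : ℕ} (m₁ : ℕ) (hn : 1 ≤ n) (hR : 2 * R' + ρ ≤ n) (hρL : ρ ≤ 3 * (n * ℓ) / shearUnit n h + 1)
    (hW : 2 * (n * ℓ / shearUnit n h + 1) ≤ 2 * (q + (N + 1) * R') + (N + 1) * dS n ℓ h) :
    ParkOK (kgPark₁Y n ℓ h v R' ρ q W N m₁) :=
  xParkPrmW_ok hn hR hρL (by omega) (by
    show -((kgA₁Ym n v R' W N : ℕ) : ℤ) ≤ ((kgA₁Yp n v R' W N : ℕ) : ℤ)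
    linarith [Int.natCast_nonneg (kgA₁Ym n v R' W N), Int.natCast_nonneg (kgA₁Yp n v R' W N)])

/-- **SLOT LEDGER, phase 3 (y-direction)**: the y′-parking rows `|v| ≤ n`, `n + |h| ≤ nℓ + 1`, `2R′ + ρ ≤ ⌊(nℓ − c + 1)/c⌋`, `ρ + |v| ≤ n`,
`2(n + |v|) ≤ Wm₂ + Wp₂`. [this work] -/
theorem kgPark₂Y_ok {n ℓ : ℕ} {h v : ℤ} {R' ρ q W N : ℕ} (m₁ : ℕ) {Wm₂ Wp₂ : ℕ} (m₂ : ℕ) (hn : 1 ≤ n) (hv : |v| ≤ n)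
    (hlay : (n + h.natAbs : ℕ) ≤ (n : ℤ) * ℓ + 1)
    (hR : (2 * R' + ρ : ℤ) ≤ ((n : ℤ) * ℓ - (shearUnit n h : ℕ) + 1) / (shearUnit n h : ℕ))
    (hρv : (ρ : ℤ) + |v| ≤ n) (hW : 2 * ((n : ℤ) + |v|) ≤ Wm₂ + Wp₂) :
    ParkOK (kgPark₂Y n ℓ h v R' ρ q W N m₁ Wm₂ Wp₂ m₂) :=
  yParkPrmW_ok hn hv hlay hR hρv hW (by
    show (kgPark₁Y n ℓ h v R' ρ q W N m₁).bLo (m₁ + 1) ≤ (kgPark₁Y n ℓ h v R' ρ q W N m₁).bHi (m₁ + 1)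
    simp only [ParkPrm.bLo, ParkPrm.bHi]; push_cast; nlinarith [Int.natCast_nonneg ((kgPark₁Y n ℓ h v R' ρ q W N m₁).g),
      Int.natCast_nonneg (kgPark₁Y n ℓ h v R' ρ q W N m₁).Wm, Int.natCast_nonneg (kgPark₁Y n ℓ h v R' ρ q W N m₁).Wp])

/-! ## §2 The two joins, discharged; the corridor schedule -/

section Sched

variable {n ℓ : ℕ} {h v : ℤ} {R' ρ q W N m₁ Wm₂ Wp₂ m₂ : ℕ} (hn : 1 ≤ n) (hv : |v| ≤ n) (hlay : (n + h.natAbs : ℕ) ≤ (n : ℤ) * ℓ + 1)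
  (hP₁ : ParkOK (kgPark₁Y n ℓ h v R' ρ q W N m₁)) (hP₂ : ParkOK (kgPark₂Y n ℓ h v R' ρ q W N m₁ Wm₂ Wp₂ m₂))
  (hsplit : (Wm₂ : ℤ) + Wp₂ = (kgPark₁Y n ℓ h v R' ρ q W N m₁).aHi (m₁ + 1) - ParkPrm.aLo (kgPark₁Y n ℓ h v R' ρ q W N m₁) (m₁ + 1))

include hn hv hlay in
/-- **JOIN 1 (y-direction)**: phase 2's start box IS the y′-run's last core. [this work] -/
theorem kgJoin₁Y : ScheduleNP.core ((kgPark₁Y n ℓ h v R' ρ q W N m₁).scheduleNP (oth (oth 0)) (σ := 1) (Or.inl rfl) (kgC₁Y n ℓ h v N) hP₁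
      (xParkPrmW_eb n ℓ h R' ρ _ _ _ _ m₁)) 0 =
    ScheduleNP.core (((yRunPrmB n ℓ h v R' q W N).scheduleN (oth 0) (σ := 1) (Or.inl rfl) 0 (yRunPrmB_ok hn hv hlay R' q W N)
      (yRunPrmB_eb n ℓ h v R' q W N)).toNPρ ρ) ((yRunPrmB n ℓ h v R' q W N).N + 1) := by
  have hvn : ((n + v).toNat : ℤ) = n + v := Int.toNat_of_nonneg (by have := abs_le.1 hv; omega)
  have hvp : ((n - v).toNat : ℤ) = n - v := Int.toNat_of_nonneg (by have := abs_le.1 hv; omega)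
  have hdS := dS_eq (ℓ := ℓ) (h := h) hn v R' q W N
  refine park_core_zero_eq_run_core (Or.inl rfl) (yRunPrmB_ok hn hv hlay R' q W N) (yRunPrmB_eb n ℓ h v R' q W N) hP₁ _ ρ ?_ ?_ ?_ ?_
  · simp only [kgPark₁Y, xParkPrmW, kgA₁Ym, RunPrm.bLo, oth_oth, kgC₁Y_zero, Pi.zero_apply]
    show -(((n + v).toNat + W + (N + 1) * R' : ℕ) : ℤ) = _
    simp only [yRunPrmB, yPrmW]; push_cast; rw [hvn]; ring
  · simp only [kgPark₁Y, xParkPrmW, kgA₁Yp, RunPrm.bHi, oth_oth, kgC₁Y_zero, Pi.zero_apply]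
    show (((n - v).toNat + W + (N + 1) * R' : ℕ) : ℤ) = _
    simp only [yRunPrmB, yPrmW]; push_cast; rw [hvp]; ring
  · simp only [kgPark₁Y, xParkPrmW, RunPrm.aLo, oth_zero, kgC₁Y_one, Pi.zero_apply]
    show -((q + (N + 1) * R' : ℕ) : ℤ) = _
    simp only [yRunPrmB, yPrmW]; push_cast; ring
  · simp only [kgPark₁Y, xParkPrmW, RunPrm.aHi, oth_zero, kgC₁Y_one, Pi.zero_apply]
    show ((q + (N + 1) * R' + (N + 1) * dS n ℓ h : ℕ) : ℤ) = _
    have e : ((q + (N + 1) * R' + (N + 1) * dS n ℓ h : ℕ) : ℤ) = q + (N + 1) * R' + (N + 1) * ((dS n ℓ h : ℕ) : ℤ) := by push_cast; ring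
    rw [e, hdS]; simp only [yRunPrmB, yPrmW]; push_cast; ring

include hsplit in
/-- **JOIN 2 (y-direction)**: phase 3's start box IS phase 2's last core (given the window split). [this work] -/
theorem kgJoin₂Y : ScheduleNP.core ((kgPark₂Y n ℓ h v R' ρ q W N m₁ Wm₂ Wp₂ m₂).scheduleNP (oth 0) (σ := 1) (Or.inl rfl)
      (kgC₂Y n ℓ h v R' ρ q W N m₁ Wp₂) hP₂ (yParkPrmW_eb n ℓ h v R' ρ _ _ _ _ m₂)) 0 =
    ScheduleNP.core ((kgPark₁Y n ℓ h v R' ρ q W N m₁).scheduleNP (oth (oth 0)) (σ := 1) (Or.inl rfl) (kgC₁Y n ℓ h v N) hP₁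
      (xParkPrmW_eb n ℓ h R' ρ _ _ _ _ m₁)) ((kgPark₁Y n ℓ h v R' ρ q W N m₁).N + 1) := by
  have hN : (kgPark₁Y n ℓ h v R' ρ q W N m₁).N = m₁ := rfl
  refine park_core_zero_eq_park_core (a := oth 0) (Or.inl rfl) hP₁ (xParkPrmW_eb n ℓ h R' ρ _ _ _ _ m₁) hP₂ (yParkPrmW_eb n ℓ h v R' ρ _ _ _ _ m₂)
    ?_ ?_ ?_ ?_
  · rw [hN]; simp only [oth_zero, kgC₁Y_one, kgC₂Y_one, sub_self, mul_zero, add_zero]; rfl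
  · rw [hN]; simp only [oth_zero, kgC₁Y_one, kgC₂Y_one, sub_self, mul_zero, add_zero]; rfl
  · rw [hN]; simp only [oth_oth, kgC₁Y_zero, kgC₂Y_zero]
    show -((Wm₂ : ℕ) : ℤ) = _
    linarith [hsplit]
  · rw [hN]; simp only [oth_oth, kgC₁Y_zero, kgC₂Y_zero]
    show ((Wp₂ : ℕ) : ℤ) = _
    ring

/-- **THE K-G CORRIDOR SCHEDULE OF RECORD, SECOND AXIS** (run along axis `1`, across-parking along axis `0`, along-parking along axis `1`, all in the
x-run frame's coordinates, schedule sign `1`, origins `0, kgC₁Y, kgC₂Y`). [this work] -/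
def kgCorrSchedY : ScheduleNP :=
  corrSchedNP (yRunPrmB n ℓ h v R' q W N) (kgPark₁Y n ℓ h v R' ρ q W N m₁) (kgPark₂Y n ℓ h v R' ρ q W N m₁ Wm₂ Wp₂ m₂) (oth 0) (σ := 1)
    (Or.inl rfl) 0 (kgC₁Y n ℓ h v N) (kgC₂Y n ℓ h v R' ρ q W N m₁ Wp₂) (yRunPrmB_ok hn hv hlay R' q W N) (yRunPrmB_eb n ℓ h v R' q W N) hP₁
    (xParkPrmW_eb n ℓ h R' ρ _ _ _ _ m₁) hP₂ (yParkPrmW_eb n ℓ h v R' ρ _ _ _ _ m₂) rfl rfl rfl (kgJoin₁Y hn hv hlay hP₁)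
    (kgJoin₂Y hP₁ hP₂ hsplit)

/-- Parameters of the y-corridor of record. [folklore] -/
theorem kgCorrSchedY_params : (kgCorrSchedY hn hv hlay hP₁ hP₂ hsplit).N = N + 1 + m₁ + 1 + m₂ ∧ (kgCorrSchedY hn hv hlay hP₁ hP₂ hsplit).R' = R' ∧
    (kgCorrSchedY hn hv hlay hP₁ hP₂ hsplit).ρ = ρ := ⟨rfl, rfl, rfl⟩

/-! ## §3 The start box and the arrival box -/

/-- **THE START BOX (y-direction)**: `y ∈ core 0 ↔ |y₁| ≤ q ∧ −((n+v)⁺ + W) ≤ y₀ ≤ (n−v)⁺ + W`. [this work] -/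
theorem mem_kgCorrSchedY_core_zero {y : Site 2} : y ∈ (kgCorrSchedY hn hv hlay hP₁ hP₂ hsplit).core 0 ↔
    (-(q : ℤ) ≤ y 1 ∧ y 1 ≤ q) ∧ (-(((n + v).toNat + W : ℕ) : ℤ) ≤ y 0 ∧ y 0 ≤ (((n - v).toNat + W : ℕ) : ℤ)) := by
  rw [kgCorrSchedY, mem_corrSchedNP_core_zero]
  simp only [yRunPrmB, yPrmW, oth_zero, oth_one', Pi.zero_apply, sub_zero, one_mul]

/-- **THE ARRIVAL BOX (y-direction), EXPLICIT**: if phase 3 parks (`2(q + (N+1)R′) + (N+1)dS + 2(m₁+1)(R′ + ρ) ≤ sHi₂ + ρ − 1 + (m₂+1)(sLo₂ − 2R′ − ρ)`,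
`sLo₂/sHi₂` of `yPrmW`), every `y` of the last core has `X − (sHi₂ + ρ − 1) ≤ y₁ − (N+1)sLo ≤ X`, `X = q + (N+1)R′ + (N+1)dS + (m₁+1)(R′+ρ) + (m₂+1)(R′+ρ)`,
and `−Wm₂ − (m₂+1)(R′ + ρ + |v|) ≤ y₀ − s ≤ Wp₂ + (m₂+1)(R′ + ρ + |v|)` with `s = (N+1)v + A⁺ + (m₁+1)(R′+ρ) − Wp₂`. [this work] -/
theorem kgCorrSchedY_core_last_subset
    (hpark : 2 * ((q : ℤ) + (N + 1) * R') + (N + 1) * (dS n ℓ h : ℕ) + 2 * ((m₁ : ℤ) + 1) * (R' + ρ) ≤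
      ((n : ℤ) * ℓ / (shearUnit n h : ℕ) + 1) + ρ - 1 + ((m₂ : ℤ) + 1) * ((((n : ℤ) * ℓ - (shearUnit n h : ℕ) + 1) / (shearUnit n h : ℕ)) - 2 * R' - ρ))
    {y : Site 2} (hy : y ∈ (kgCorrSchedY hn hv hlay hP₁ hP₂ hsplit).core ((kgCorrSchedY hn hv hlay hP₁ hP₂ hsplit).N + 1)) :
    ((q : ℤ) + (N + 1) * R' + (N + 1) * (dS n ℓ h : ℕ) + ((m₁ : ℤ) + 1) * (R' + ρ) + ((m₂ : ℤ) + 1) * (R' + ρ) - (((n : ℤ) * ℓ / (shearUnit n h : ℕ) + 1) + ρ - 1) ≤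
        y 1 - ((N : ℤ) + 1) * (((n : ℤ) * ℓ - (shearUnit n h : ℕ) + 1) / (shearUnit n h : ℕ)) ∧
      y 1 - ((N : ℤ) + 1) * (((n : ℤ) * ℓ - (shearUnit n h : ℕ) + 1) / (shearUnit n h : ℕ)) ≤
        (q : ℤ) + (N + 1) * R' + (N + 1) * (dS n ℓ h : ℕ) + ((m₁ : ℤ) + 1) * (R' + ρ) + ((m₂ : ℤ) + 1) * (R' + ρ)) ∧
    (-(Wm₂ : ℤ) - ((m₂ : ℤ) + 1) * (R' + ρ + |v|) ≤ y 0 - (((N : ℤ) + 1) * v + (((kgA₁Yp n v R' W N : ℕ) : ℤ) + ((m₁ : ℤ) + 1) * (R' + ρ)) - Wp₂) ∧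
      y 0 - (((N : ℤ) + 1) * v + (((kgA₁Yp n v R' W N : ℕ) : ℤ) + ((m₁ : ℤ) + 1) * (R' + ρ)) - Wp₂) ≤ (Wp₂ : ℤ) + ((m₂ : ℤ) + 1) * (R' + ρ + |v|)) := by
  have hg₁ : ((kgPark₁Y n ℓ h v R' ρ q W N m₁).g : ℤ) = R' + ρ := by
    rw [ParkPrm.g_eq]; simp [kgPark₁Y, xParkPrmW]
  have hg₂ : ((kgPark₂Y n ℓ h v R' ρ q W N m₁ Wm₂ Wp₂ m₂).g : ℤ) = R' + ρ + |v| := by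
    rw [ParkPrm.g_eq]; simp [kgPark₂Y, yParkPrmW]
  have hA₂ : (kgPark₂Y n ℓ h v R' ρ q W N m₁ Wm₂ Wp₂ m₂).A = (q : ℤ) + (N + 1) * R' + (N + 1) * (dS n ℓ h : ℕ) + ((m₁ : ℤ) + 1) * (R' + ρ) := by
    show (kgPark₁Y n ℓ h v R' ρ q W N m₁).bHi (m₁ + 1) = _
    simp only [ParkPrm.bHi]; push_cast; rw [hg₁]; simp [kgPark₁Y, xParkPrmW]
  have hA₂' : (kgPark₂Y n ℓ h v R' ρ q W N m₁ Wm₂ Wp₂ m₂).aLo0 = -((q : ℤ) + (N + 1) * R') - ((m₁ : ℤ) + 1) * (R' + ρ) := by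
    show (kgPark₁Y n ℓ h v R' ρ q W N m₁).bLo (m₁ + 1) = _
    simp only [ParkPrm.bLo]; push_cast; rw [hg₁]; simp [kgPark₁Y, xParkPrmW]
  have hpark' : (kgPark₂Y n ℓ h v R' ρ q W N m₁ Wm₂ Wp₂ m₂).A - (kgPark₂Y n ℓ h v R' ρ q W N m₁ Wm₂ Wp₂ m₂).aLo0 ≤
      (kgPark₂Y n ℓ h v R' ρ q W N m₁ Wm₂ Wp₂ m₂).sHi + (kgPark₂Y n ℓ h v R' ρ q W N m₁ Wm₂ Wp₂ m₂).ρ - 1 +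
        (((kgPark₂Y n ℓ h v R' ρ q W N m₁ Wm₂ Wp₂ m₂).N + 1 : ℕ) : ℤ) *
          ((kgPark₂Y n ℓ h v R' ρ q W N m₁ Wm₂ Wp₂ m₂).sLo - 2 * (kgPark₂Y n ℓ h v R' ρ q W N m₁ Wm₂ Wp₂ m₂).ea -
            (kgPark₂Y n ℓ h v R' ρ q W N m₁ Wm₂ Wp₂ m₂).ρ) := by
    rw [hA₂, hA₂']
    simp only [kgPark₂Y, yParkPrmW]; push_cast; linarith
  have hlast := corrSchedNP_core_last_subset (yRunPrmB n ℓ h v R' q W N) (kgPark₁Y n ℓ h v R' ρ q W N m₁)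
    (kgPark₂Y n ℓ h v R' ρ q W N m₁ Wm₂ Wp₂ m₂) (oth 0) (σ := 1) (Or.inl rfl) 0 (kgC₁Y n ℓ h v N) (kgC₂Y n ℓ h v R' ρ q W N m₁ Wp₂)
    (yRunPrmB_ok hn hv hlay R' q W N) (yRunPrmB_eb n ℓ h v R' q W N) hP₁ (xParkPrmW_eb n ℓ h R' ρ _ _ _ _ m₁) hP₂
    (yParkPrmW_eb n ℓ h v R' ρ _ _ _ _ m₂) rfl rfl rfl (kgJoin₁Y hn hv hlay hP₁) (kgJoin₂Y hP₁ hP₂ hsplit) hpark' hy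
  rw [hA₂, hg₂] at hlast
  simp only [oth_zero, oth_one', kgC₂Y_zero, kgC₂Y_one, one_mul] at hlast
  have eHi : (kgPark₁Y n ℓ h v R' ρ q W N m₁).aHi (m₁ + 1) = ((kgA₁Yp n v R' W N : ℕ) : ℤ) + ((m₁ : ℤ) + 1) * (R' + ρ) := by
    simp only [ParkPrm.aHi, kgPark₁Y, xParkPrmW]; push_cast; ring
  rw [eHi] at hlast
  have e2 : ((kgPark₂Y n ℓ h v R' ρ q W N m₁ Wm₂ Wp₂ m₂).N : ℤ) = m₂ := rfl
  have e3 : ((kgPark₂Y n ℓ h v R' ρ q W N m₁ Wm₂ Wp₂ m₂).ea : ℤ) = R' := rfl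
  have e4 : ((kgPark₂Y n ℓ h v R' ρ q W N m₁ Wm₂ Wp₂ m₂).ρ : ℤ) = ρ := rfl
  have e5 : (kgPark₂Y n ℓ h v R' ρ q W N m₁ Wm₂ Wp₂ m₂).sHi = (n : ℤ) * ℓ / (shearUnit n h : ℕ) + 1 := rfl
  have e6 : ((kgPark₂Y n ℓ h v R' ρ q W N m₁ Wm₂ Wp₂ m₂).Wm : ℤ) = Wm₂ := rfl
  have e7 : ((kgPark₂Y n ℓ h v R' ρ q W N m₁ Wm₂ Wp₂ m₂).Wp : ℤ) = Wp₂ := rfl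
  simp only [Nat.cast_add, Nat.cast_one, e2, e3, e4, e5, e6, e7] at hlast
  obtain ⟨⟨h1, h2⟩, h3, h4⟩ := hlast
  refine ⟨⟨by linarith, by linarith⟩, by linarith, by linarith⟩

end Sched

end Skelφ

end Summit.CriticalPhenomena.PercolationContinuityZ3.Theorems.Transplant

end
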